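import Summits.AtomisticToContinuum.Crystallization.Theorems.FrustratedLawDichotomyTwoShellRigidityLsEntry
import Summits.AtomisticToContinuum.Crystallization.Theorems.FrustratedLawDichotomyTwoShellRigidityGaugeFixRational
import Summits.AtomisticToContinuum.Crystallization.Theorems.FrustratedLawDichotomySphericalLinkCert
import Summits.AtomisticToContinuum.Crystallization.Theorems.FrustratedLawDichotomyLinkIsoToolkit
import Summits.AtomisticToContinuum.Crystallization.Theorems.FrustratedLawDichotomyCappedRigidityCertPatterns
import Summits.AtomisticToContinuum.Crystallization.Theorems.FrustratedLawDichotomyBondGraphWindows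

/-!
# FrustratedLawDichotomy · two-shell rigidity — the RE-GAUGING LEDGER of the least-squares-gauged entry, KERNEL-CHECKED

**This file is part A/4 «Frame» (§1–§3) of the node** — the ledger (§4: `lsRot`, gauge equation, bootstrap) is
`…LsLedgerLedger`, the sphere-to-frame transfer (§5) is `…LsLedgerSphere`, and the kernel arrow with the ONE `Prop`
`SphericalLsFit`, `ledgerStep`, `slop₁/slop₃` and the fcc/hcp corollaries (§6) is `…LsLedgerArrow` (same namespace throughout;
split for the ≤ 400-line rule, critic row 662 (B)(2)).  The description below is the NODE's.
# (decomp-a2c, lens 3 «one certified translation + split beneath», gen 34; critic row 650 (6); beneath `…TwoShellRigidityLsEntry`, p840193)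

Target (tree): `LsEntryAt Pat P := GEntryAt Pat probes26 (lsGauge Pat) (1/100) P` — the one open input beneath slot 3 of
`OverbindingBudgetTwoShellShape` (`…LsEntry.cappedRigidityBothAt_of_lsEntry`, `twoShellShapeV_of_lsEntries`).  Gen 33 planned it as
`CapBrace ∧ ProcrustesGauge ∧ ⟨braced Rig run⟩ ∧ CapAprioriAt`, with the «re-gauge ledger» — the algebra that turns a per-leaf FIRST-ORDER
certificate read in a FIXED frame into bounds on the residuals of the least-squares-GAUGED frame — left informal (g33/MEMO.md §3: axis–angle of
the frame rotation + Procrustes minimality, i.e. SO(3) structure theory Mathlib does not have).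

THIS NODE proves the ledger as a kernel arrow by coordinate algebra alone — no SO(3) theory, no compactness, no calculus; `ProcrustesGauge`
is NOT needed (the tree's `GaugeFix`, proved at both patterns, replaces it):

  `GEntryAt Pat D (lsGauge Pat) θ (V₁ + slop₁, Kq·θ, V₃ + slop₃, (Kq+K)·θ)`
  `    ⟸ CapBrace β θ Pat ∧ SphericalLsFit β θ Pat D α Ω V₁ V₃ ∧ [GaugeFix Pat (lsGauge Pat) κ ∧ CapAprioriAt Kq K θ Pat ∧ frame/cover/separation`
  `       facts — ALL PROVED IN THE TREE] ∧ decidable arithmetic (ledgerStep^[k](κ₁·a) ≤ T, ρ·(V₁ + slop₁) ≤ K·θ)`      (`gEntryAt_lsGauge_of_sphericalLsFit`)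

and, at the registered literals (`θ = 1/100`, `D = probes26`, `ρ = 11281/10000`, `κ₁ = 3465/1000 ≥ 2√3`, cap a-priori by trilateration),

  `LsEntryAt Pat P ⟸ CapBrace β (1/100) Pat ∧ SphericalLsFit β (1/100) Pat probes26 α Ω V₁ V₃ ∧ arithmetic`,  `Pat ∈ {fcc, hcp}`
  (`lsEntryAt_fcc_of_sphericalLsFit`, `lsEntryAt_hcp_of_sphericalLsFit`).

PIECES (tags).
* `CapBrace β θ Pat` [tree definition, `…TwoShellRigidityLsEntry`; ATTACKABLE·S — the octahedral cell lemma sharpened from `22θ`, or a 6-point LP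
  certificate; measured need `β ≤ 1/10`, first-order truth `3θ`].  Used ONLY to hand the brace window to the finite statement.
* `SphericalLsFit β θ Pat D α Ω V₁ V₃` [NEW, defined here; INSTRUMENTABLE; certificate class = braced interval branch-and-bound of the accepted
  12-direction `Rig` engine + per-leaf LINEAR-TARGET rows (g33/MEMO.md §2)]: for every dozen of UNIT vectors `e : Pat → S²` in the three cosine
  windows of `LinkIso θ` and the square-diagonal brace `|⟪e u, e v⟫| ≤ β`, some frame `A` (the leaf frame) has (F0) `‖A⁻¹e_u − u‖ ≤ α`,
  (F1) `‖lsRot a‖ ≤ Ω` (`a_u = A⁻¹e_u − u`, `lsRot a = (1/8) Σ_u u × a_u`), (F2) `⟪n, a_u − (lsRot a) × u⟫ ≤ V₁`, (F3) the contact differences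
  `≤ V₃`, for all probes `n ∈ D`.  All four are LINEAR in `a` for fixed `A` ((F0) ⟺ `⟪A u, e_u⟫ ≥ 1 − α²/2`).
* Discharged from the tree in the corollaries: `GaugeFix` (`…GaugeFixPatterns.gaugeFix_fcc/hcp`, `κ = 2√3`; `…GaugeFixRational.two_sqrt_three_le`),
  the tight frame `Σ_u ⟪u, z⟫ u = 4 z` (`frame_fcc/hcp`), `CapAprioriAt` (`…LadderCap.capAprioriAt_trilateration_fcc/hcp`), the covering constant
  (`…GaugedLadderD.coversProbes26`, `norm_le_one_of_mem_probes26`), contact separation (`…CappedRigidityCertPatterns.fcc/hcp_contactSeparating`),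
  the windows (`…BondGraphWindows`, `…SphericalLinkCert`, `…LinkIsoToolkit`).

THE MATHEMATICS (all `[folklore]`; new as a typed arrow).  `p_u = (y(τu) − y_i)/nn_i`, `e_u = p_u/‖p_u‖`, `A₀` the frame of `SphericalLsFit`,
`a_u = A₀⁻¹e_u − u`, `d_u = A₀⁻¹p_u − u = a_u + (‖p_u‖ − 1)(u + a_u)` (§5: `‖d_u‖ ≤ a := aTot θ α = θ + (1+θ)α`, and `u × (d_u − a_u) = (‖p_u‖ − 1)·u × a_u`
so `‖lsRot d − lsRot a‖ ≤ (3/2)θα`); `B` the `GaugeFix`ed frame (`Σ_u u × (B⁻¹p_u − u) = 0`, `‖B − A₀‖ ≤ κ a`), `R = B⁻¹A₀`.  Then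
`B⁻¹p_u − u = d_u + (R u − u) + (R d_u − d_u)`; `R v − v = rotVec R × v + symPart R v` with `‖symPart R v‖ ≤ (t²/2)‖v‖` under an operator bound
`‖R v − v‖ ≤ t‖v‖` (§2); the tight-frame ISOTROPY `Σ_u u × (ω × u) = 8ω`, `Σ_u u × symPart R u = 0` (§3, from `Σ_u ⟪u, z⟫ u = 4z` alone) turns the
gauge equation into `rotVec R = −lsRot d − (1/8) Σ_u u × (R d_u − d_u)` (§4), whence `‖rotVec R + lsRot d‖ ≤ (3/2)·t·a` and the BOOTSTRAP
`t ↦ ledgerStep L a t = L + (3/2)·t·a + t²/2` (`L = Ω + (3/2)θα ≥ ‖lsRot d‖`, from `t₀ = κ₁·a`; `iterate_ledgerStep_le_of_chain` discharges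
`ledgerStep^[k] t₀ ≤ T` by a chain of small rationals); finally `⟪n, B⁻¹p_u − u⟫ ≤ ⟪n, a_u − (lsRot a) × u⟫ + slop₁ θ α T` and the contact analogue
with `slop₃` (§4–§5); caps through `Covers D ρ` + `CapAprioriAt` exactly as in `…GaugedLadderC.gEntryAt_noGauge_of_coarse`.
`slop₁ = θ(1+α) + (3/2)θα + (3/2)Ta + T²/2 + Ta`, `slop₃ = 2θ(1+α) + (3/2)θα + (3/2)Ta + T²/2 + 2Ta`.

NUMBERS (memo level; worked `example`s at the end of §6): `θ = 1/100`, `α = 11/100`, `Ω = 3/40` ⇒ `t₀ = 0.4196`, chain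
`0.42 → 0.25 → 0.16 → 0.12 → 0.106 → 0.102 → 0.101`, `T = 101/1000`, `slop₁ = 0.0484`, `slop₃ = 0.0718`; the slop is driven by `Ω` (leaf frame vs
its own least-squares frame): `Ω = 1/50 ⇒ T ≈ 0.027, slop₁ ≈ 0.021`.

WHY NOVEL.  The tree's only re-gauging step (`…GaugedLadderC.regaugeAt_of_gaugeFix`) charges the FULL rotation `B⁻¹A₀ − 1` against the residuals
and inflates an entry by `(1+κ)ρ ≈ 3.9×` — circular at `θ = 1/100`; this ledger identifies that rotation to first order with the leaf's own
least-squares rotation `lsRot a` through the isotropy of the kissing frame and pays only the second-order terms `t·a`, `t²`, so a first-order leaf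
certificate survives re-gauging with an ADDITIVE slop (≈ `0.02–0.05`), and the analytic side needs nothing beyond `GaugeFix` (in tree).

Contents: §1 coordinates and the cross product on `E3`; §2 matrix entries, `rotVec`, `symPart`, `dev_eq`; §3 tight-frame isotropy, `lsGauge` in
cross-product form; §4 the ledger core (`lsRot`, `rotVec_eq_of_gauge`, bootstrap `ledgerStep`, residual bounds); §5 sphere → frame comparison
(`frameRes`, `derot`, `aTot`); §6 `SphericalLsFit`, `slop₁/₃`, the arrow, both patterns, worked arithmetic.  Thirteen definitions: twelve data (`cross`, `bv`,
`ent`, `rotVec`, `symPart`, `lsRot`, `ledgerStep`, `frameRes`, `derot`, `aTot`, `slop₁`, `slop₃`) and ONE `Prop` (`SphericalLsFit`, the finite target).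
No `sorry`, standard axioms, no `instance`/`notation`.
-/

noncomputable section

namespace Summit.AtomisticToContinuum.Crystallization.Theorems.FrustratedLawDichotomyTwoShellRigidityLsLedger

open Literature.Geometry.DiscreteGeometry
open Summit.AtomisticToContinuum.Crystallization.Theorems.FrustratedLawDichotomyTwoShellRigidityCut
open Summit.AtomisticToContinuum.Crystallization.Theorems.FrustratedLawDichotomyTwoShellRigidityCells
open Summit.AtomisticToContinuum.Crystallization.Theorems.FrustratedLawDichotomyTwoShellRigidityGaugedLadder
open Summit.AtomisticToContinuum.Crystallization.Theorems.FrustratedLawDichotomyTwoShellRigidityLsEntry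
open scoped RealInnerProductSpace
open Literature.Geometry.DiscreteGeometry.ShellCensus (bv bv_apply norm_bv inner_bv_left)

/-! ## §1 Vectors of `ℝ³` in coordinates; the cross product -/

/-- Extensionality in the three coordinates. [folklore] -/
theorem ext3 {v w : E3} (h0 : v 0 = w 0) (h1 : v 1 = w 1) (h2 : v 2 = w 2) : v = w := by
  ext k
  fin_cases k
  · exact h0
  · exact h1
  · exact h2

/-- first coordinate of `vec3`. [lens-3 g34] -/
@[simp] theorem vec3_apply_zero (a b c : ℝ) : vec3 a b c 0 = a := by simp [vec3]
/-- second coordinate of `vec3`. [lens-3 g34] -/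
@[simp] theorem vec3_apply_one (a b c : ℝ) : vec3 a b c 1 = b := by simp [vec3]
/-- third coordinate of `vec3`. [lens-3 g34] -/
@[simp] theorem vec3_apply_two (a b c : ℝ) : vec3 a b c 2 = c := by simp [vec3]

/-- A coordinate of a finite sum of vectors is the sum of the coordinates. [folklore] -/
theorem finset_sum_apply {ι : Type*} (s : Finset ι) (f : ι → E3) (k : Fin 3) :
    (∑ j ∈ s, f j) k = ∑ j ∈ s, f j k := by
  classical
  induction s using Finset.induction_on with
  | empty => simp
  | insert a s ha ih => rw [Finset.sum_insert ha, Finset.sum_insert ha, PiLp.add_apply, ih]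

/-- **The cross product** on `E3 = EuclideanSpace ℝ (Fin 3)`, in coordinates. (Kept as a coordinate definition on `E3 = EuclideanSpace ℝ (Fin 3)` rather than a wrapper of Mathlib's
`crossProduct : (Fin 3 → R) →ₗ[R] (Fin 3 → R) →ₗ[R] Fin 3 → R` — same orientation — because every use below is through the three
`@[simp]` coordinate lemmas and `ext3 <;> simp <;> ring` on `PiLp` points; a `WithLp.toLp ∘ crossProduct ∘ ofLp` wrapper would only add
coercion noise here.  Reviewer note p840498 (3).) -/
def cross (a b : E3) : E3 :=
  vec3 (a 1 * b 2 - a 2 * b 1) (a 2 * b 0 - a 0 * b 2) (a 0 * b 1 - a 1 * b 0)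

/-- first coordinate of the cross product. [lens-3 g34] -/
@[simp] theorem cross_apply_zero (a b : E3) : cross a b 0 = a 1 * b 2 - a 2 * b 1 := by simp [cross]
/-- second coordinate of the cross product. [lens-3 g34] -/
@[simp] theorem cross_apply_one (a b : E3) : cross a b 1 = a 2 * b 0 - a 0 * b 2 := by simp [cross]
/-- third coordinate of the cross product. [lens-3 g34] -/
@[simp] theorem cross_apply_two (a b : E3) : cross a b 2 = a 0 * b 1 - a 1 * b 0 := by simp [cross]

/-- `u × u = 0`. [lens-3 g34] -/
theorem cross_self (a : E3) : cross a a = 0 := by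
  apply ext3 <;> simp <;> ring

/-- `u × 0 = 0`. [lens-3 g34] -/
@[simp] theorem cross_zero_right (a : E3) : cross a 0 = 0 := by
  apply ext3 <;> simp

/-- `0 × v = 0`. [lens-3 g34] -/
@[simp] theorem cross_zero_left (a : E3) : cross 0 a = 0 := by
  apply ext3 <;> simp

/-- additivity of the cross product in the second slot. [lens-3 g34] -/
theorem cross_add_right (a b c : E3) : cross a (b + c) = cross a b + cross a c := by
  apply ext3 <;> simp <;> ring

/-- the cross product commutes with subtraction in the second slot. [lens-3 g34] -/
theorem cross_sub_right (a b c : E3) : cross a (b - c) = cross a b - cross a c := by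
  apply ext3 <;> simp <;> ring

/-- homogeneity of the cross product in the second slot. [lens-3 g34] -/
theorem cross_smul_right (a b : E3) (r : ℝ) : cross a (r • b) = r • cross a b := by
  apply ext3 <;> simp <;> ring

/-- additivity of the cross product in the first slot. [lens-3 g34] -/
theorem cross_add_left (a b c : E3) : cross (a + b) c = cross a c + cross b c := by
  apply ext3 <;> simp <;> ring

/-- the cross product commutes with subtraction in the first slot. [lens-3 g34] -/
theorem cross_sub_left (a b c : E3) : cross (a - b) c = cross a c - cross b c := by
  apply ext3 <;> simp <;> ring

/-- `(−u) × v = −(u × v)`. [lens-3 g34] -/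
theorem cross_neg_left (a b : E3) : cross (-a) b = -cross a b := by
  apply ext3 <;> simp <;> ring

/-- homogeneity of the cross product in the first slot. [lens-3 g34] -/
theorem cross_smul_left (a b : E3) (r : ℝ) : cross (r • a) b = r • cross a b := by
  apply ext3 <;> simp <;> ring

/-- `Σ_j cross a (f j) = cross a (Σ_j f j)`. [folklore] -/
theorem cross_finset_sum_right {ι : Type*} (s : Finset ι) (a : E3) (f : ι → E3) :
    cross a (∑ j ∈ s, f j) = ∑ j ∈ s, cross a (f j) := by
  classical
  induction s using Finset.induction_on with
  | empty => simp
  | insert b s hb ih => rw [Finset.sum_insert hb, Finset.sum_insert hb, cross_add_right, ih]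

/-- Lagrange: `‖a × b‖² = ‖a‖²‖b‖² − ⟪a, b⟫²`. [folklore] -/
theorem norm_cross_sq (a b : E3) : ‖cross a b‖ ^ 2 = ‖a‖ ^ 2 * ‖b‖ ^ 2 - ⟪a, b⟫ ^ 2 := by
  rw [norm_sq_fin3, norm_sq_fin3, norm_sq_fin3, inner_fin3]
  simp only [cross_apply_zero, cross_apply_one, cross_apply_two]
  ring

/-- `‖a × b‖ ≤ ‖a‖ ‖b‖`. [folklore] -/
theorem norm_cross_le (a b : E3) : ‖cross a b‖ ≤ ‖a‖ * ‖b‖ := by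
  have h : ‖cross a b‖ ^ 2 ≤ (‖a‖ * ‖b‖) ^ 2 := by
    rw [norm_cross_sq]; nlinarith [sq_nonneg ⟪a, b⟫]
  calc ‖cross a b‖ = Real.sqrt (‖cross a b‖ ^ 2) := (Real.sqrt_sq (norm_nonneg _)).symm
    _ ≤ Real.sqrt ((‖a‖ * ‖b‖) ^ 2) := Real.sqrt_le_sqrt h
    _ = ‖a‖ * ‖b‖ := Real.sqrt_sq (by positivity)

/-- BAC − CAB for `u × (φ × u)`. [folklore] -/
theorem cross_cross_self (u φ : E3) : cross u (cross φ u) = ⟪u, u⟫ • φ - ⟪u, φ⟫ • u := by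
  rw [inner_fin3, inner_fin3]
  apply ext3 <;> simp only [cross_apply_zero, cross_apply_one, cross_apply_two, PiLp.sub_apply, PiLp.smul_apply, smul_eq_mul] <;> ring

/-! ## §2 Basis vectors, matrix entries of an isometry, the skew part as a cross product -/

/-- inner product with a basis vector picks the coordinate (right). [lens-3 g34] -/
theorem inner_bv_right (v : E3) (k : Fin 3) : ⟪v, bv k⟫ = v k := by
  rw [real_inner_comm]; exact inner_bv_left k v

/-- Expansion in the standard basis. [folklore] -/
theorem eq_sum_bv (v : E3) : v = ∑ k, v k • bv k := by
  apply ext3 <;> simp [Fin.sum_univ_three, bv_apply]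

/-- Matrix entry `(k, l)` of a linear isometry: the `k`-th coordinate of the image of `e_l`. -/
def ent (A : E3 ≃ₗᵢ[ℝ] E3) (k l : Fin 3) : ℝ := A (bv l) k

/-- Coordinates of `A v` in terms of the matrix entries. [folklore] -/
theorem apply_coord (A : E3 ≃ₗᵢ[ℝ] E3) (v : E3) (k : Fin 3) :
    A v k = v 0 * ent A k 0 + v 1 * ent A k 1 + v 2 * ent A k 2 := by
  conv_lhs => rw [eq_sum_bv v]
  simp only [Fin.sum_univ_three, map_add, map_smul, PiLp.add_apply, PiLp.smul_apply, smul_eq_mul, ent]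

/-- The inverse of an isometry has the transposed matrix. [folklore] -/
theorem ent_symm (A : E3 ≃ₗᵢ[ℝ] E3) (k l : Fin 3) : ent A.symm k l = ent A l k := by
  unfold ent
  rw [← inner_bv_left k (A.symm (bv l)), ← inner_bv_left l (A (bv k)),
    ← A.inner_map_map (bv k) (A.symm (bv l)), A.apply_symm_apply]
  exact real_inner_comm _ _

/-- **The rotation vector** of an isometry `R`: the axial vector of the skew part `(R − R⁻¹)/2`. -/
def rotVec (R : E3 ≃ₗᵢ[ℝ] E3) : E3 :=
  vec3 ((ent R 2 1 - ent R 1 2) / 2) ((ent R 0 2 - ent R 2 0) / 2) ((ent R 1 0 - ent R 0 1) / 2)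

/-- **The skew part of an isometry acts as the cross product with its rotation vector**: `R v − R⁻¹ v = 2 · rotVec R × v`. [folklore] -/
theorem sub_symm_eq_cross (R : E3 ≃ₗᵢ[ℝ] E3) (v : E3) : R v - R.symm v = (2 : ℝ) • cross (rotVec R) v := by
  apply ext3 <;>
    simp only [PiLp.sub_apply, PiLp.smul_apply, smul_eq_mul, apply_coord R, apply_coord R.symm, ent_symm,
      cross_apply_zero, cross_apply_one, cross_apply_two, rotVec, vec3_apply_zero, vec3_apply_one, vec3_apply_two] <;>
    ring

/-- The symmetric (second-order) part of the deviation `R − 1`: `−½ (R⁻¹ − 1)(R − 1) v`. -/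
def symPart (R : E3 ≃ₗᵢ[ℝ] E3) (v : E3) : E3 := -((1 / 2 : ℝ) • (R.symm (R v - v) - (R v - v)))

/-- `symPart R v = ½ R v + ½ R⁻¹ v − v`. [folklore] -/
theorem symPart_eq (R : E3 ≃ₗᵢ[ℝ] E3) (v : E3) :
    symPart R v = (1 / 2 : ℝ) • R v + (1 / 2 : ℝ) • R.symm v - v := by
  simp only [symPart, map_sub, LinearIsometryEquiv.symm_apply_apply]
  apply ext3 <;> simp only [PiLp.add_apply, PiLp.sub_apply, PiLp.smul_apply, PiLp.neg_apply, smul_eq_mul] <;> ring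

/-- **Deviation = skew + symmetric**: `R v − v = rotVec R × v + symPart R v`. [folklore] -/
theorem dev_eq (R : E3 ≃ₗᵢ[ℝ] E3) (v : E3) : R v - v = cross (rotVec R) v + symPart R v := by
  have h := sub_symm_eq_cross R v
  have h2 : cross (rotVec R) v = (1 / 2 : ℝ) • (R v - R.symm v) := by
    rw [h, smul_smul]; norm_num
  rw [h2, symPart_eq]
  apply ext3 <;> simp only [PiLp.add_apply, PiLp.sub_apply, PiLp.smul_apply, smul_eq_mul] <;> ring

/-- `‖R⁻¹ w − w‖ = ‖R w − w‖`. [folklore] -/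
theorem norm_symm_sub (R : E3 ≃ₗᵢ[ℝ] E3) (w : E3) : ‖R.symm w - w‖ = ‖R w - w‖ := by
  rw [← R.norm_map (R.symm w - w), map_sub, R.apply_symm_apply, norm_sub_rev]

/-- **The symmetric part is second order**: `‖symPart R v‖ ≤ (t²/2)‖v‖` when `‖R v − v‖ ≤ t‖v‖` for all `v`. [folklore] -/
theorem norm_symPart_le {R : E3 ≃ₗᵢ[ℝ] E3} {t : ℝ} (ht : 0 ≤ t) (hM : ∀ v, ‖R v - v‖ ≤ t * ‖v‖) (v : E3) :
    ‖symPart R v‖ ≤ t ^ 2 / 2 * ‖v‖ := by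
  have h1 : ‖R.symm (R v - v) - (R v - v)‖ ≤ t * (t * ‖v‖) := by
    rw [norm_symm_sub]
    exact (hM _).trans (mul_le_mul_of_nonneg_left (hM v) ht)
  rw [symPart, norm_neg, norm_smul, Real.norm_of_nonneg (by norm_num : (0 : ℝ) ≤ 1 / 2)]
  nlinarith [h1, norm_nonneg v]

/-! ## §3 Isotropy of a tight frame: second moments, `Σ u × (φ × u) = 8 φ`, `Σ u × (sym u) = 0`; the gauge in cross-product form -/

section Frame

variable {Pat : Finset E3}

/-- Second moments of a tight frame `Σ_u ⟪u, z⟫ u = 4 z`: `Σ_u u_j u_l = 4 δ_jl`. [folklore] -/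
theorem moment (hframe : ∀ z : E3, ∑ u : ↥Pat, ⟪(u : E3), z⟫ • (u : E3) = (4 : ℝ) • z) (j l : Fin 3) :
    ∑ u : ↥Pat, (u : E3) j * (u : E3) l = if j = l then 4 else 0 := by
  have h := congrArg (fun w : E3 => w j) (hframe (bv l))
  simp only [finset_sum_apply, PiLp.smul_apply, smul_eq_mul, inner_bv_right, bv_apply] at h
  rw [show (∑ u : ↥Pat, (u : E3) j * (u : E3) l) = ∑ u : ↥Pat, (u : E3) l * (u : E3) j from
    Finset.sum_congr rfl fun u _ => mul_comm _ _, h]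
  split_ifs <;> norm_num

/-- Moment calculus: `Σ_u u_j (u_0 c_0 + u_1 c_1 + u_2 c_2) = 4 c_j`. [folklore] -/
theorem sum_coord_mul_lin (hframe : ∀ z : E3, ∑ u : ↥Pat, ⟪(u : E3), z⟫ • (u : E3) = (4 : ℝ) • z)
    (j : Fin 3) (c : Fin 3 → ℝ) :
    ∑ u : ↥Pat, (u : E3) j * ((u : E3) 0 * c 0 + (u : E3) 1 * c 1 + (u : E3) 2 * c 2) = 4 * c j := by
  simp only [mul_add, Finset.sum_add_distrib, ← mul_assoc, ← Finset.sum_mul]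
  rw [moment hframe j 0, moment hframe j 1, moment hframe j 2]
  fin_cases j <;> simp

/-- `Σ_u ⟪u, u⟫ = 12` (trace of the second-moment matrix). [folklore] -/
theorem sum_inner_self (hframe : ∀ z : E3, ∑ u : ↥Pat, ⟪(u : E3), z⟫ • (u : E3) = (4 : ℝ) • z) :
    ∑ u : ↥Pat, ⟪(u : E3), (u : E3)⟫ = 12 := by
  simp_rw [inner_fin3]
  rw [Finset.sum_add_distrib, Finset.sum_add_distrib, moment hframe 0 0, moment hframe 1 1, moment hframe 2 2]
  norm_num

/-- **Isotropy I**: `Σ_u u × (φ × u) = 8 φ`. [folklore] -/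
theorem sum_cross_cross (hframe : ∀ z : E3, ∑ u : ↥Pat, ⟪(u : E3), z⟫ • (u : E3) = (4 : ℝ) • z) (φ : E3) :
    ∑ u : ↥Pat, cross (u : E3) (cross φ u) = (8 : ℝ) • φ := by
  simp_rw [cross_cross_self]
  rw [Finset.sum_sub_distrib, ← Finset.sum_smul, sum_inner_self hframe, hframe φ, ← sub_smul]
  norm_num

/-- **Isotropy II (linear fields)**: for a field `F u = G u` given by a matrix `g`, `Σ_u u × F u = 4 · (g₂₁ − g₁₂, g₀₂ − g₂₀, g₁₀ − g₀₁)`;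
in particular it vanishes when `g` is symmetric. [folklore] -/
theorem sum_cross_lin (hframe : ∀ z : E3, ∑ u : ↥Pat, ⟪(u : E3), z⟫ • (u : E3) = (4 : ℝ) • z)
    {F : ↥Pat → E3} {g : Fin 3 → Fin 3 → ℝ}
    (hF : ∀ (u : ↥Pat) (k : Fin 3), F u k = (u : E3) 0 * g k 0 + (u : E3) 1 * g k 1 + (u : E3) 2 * g k 2) :
    ∑ u : ↥Pat, cross (u : E3) (F u) = (4 : ℝ) • vec3 (g 2 1 - g 1 2) (g 0 2 - g 2 0) (g 1 0 - g 0 1) := by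
  apply ext3
  · simp only [finset_sum_apply, cross_apply_zero, hF, PiLp.smul_apply, smul_eq_mul, vec3_apply_zero]
    rw [Finset.sum_sub_distrib, sum_coord_mul_lin hframe 1 (g 2), sum_coord_mul_lin hframe 2 (g 1)]; ring
  · simp only [finset_sum_apply, cross_apply_one, hF, PiLp.smul_apply, smul_eq_mul, vec3_apply_one]
    rw [Finset.sum_sub_distrib, sum_coord_mul_lin hframe 2 (g 0), sum_coord_mul_lin hframe 0 (g 2)]; ring
  · simp only [finset_sum_apply, cross_apply_two, hF, PiLp.smul_apply, smul_eq_mul, vec3_apply_two]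
    rw [Finset.sum_sub_distrib, sum_coord_mul_lin hframe 0 (g 1), sum_coord_mul_lin hframe 1 (g 0)]; ring

/-- **Isotropy III**: the symmetric part of an isometry's deviation is invisible to the least-squares gauge, `Σ_u u × symPart R u = 0`.
[folklore] -/
theorem sum_cross_symPart (hframe : ∀ z : E3, ∑ u : ↥Pat, ⟪(u : E3), z⟫ • (u : E3) = (4 : ℝ) • z) (R : E3 ≃ₗᵢ[ℝ] E3) :
    ∑ u : ↥Pat, cross (u : E3) (symPart R u) = 0 := by
  have h : ∀ u : ↥Pat, cross (u : E3) (symPart R u) = cross (u : E3) ((1 / 2 : ℝ) • R u + (1 / 2 : ℝ) • R.symm u) := by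
    intro u
    rw [symPart_eq, cross_sub_right, cross_self, sub_zero]
  have hF : ∀ (u : ↥Pat) (k : Fin 3), ((1 / 2 : ℝ) • R (u : E3) + (1 / 2 : ℝ) • R.symm (u : E3)) k =
      (u : E3) 0 * ((1 / 2 : ℝ) * ent R k 0 + (1 / 2 : ℝ) * ent R 0 k) +
      (u : E3) 1 * ((1 / 2 : ℝ) * ent R k 1 + (1 / 2 : ℝ) * ent R 1 k) +
      (u : E3) 2 * ((1 / 2 : ℝ) * ent R k 2 + (1 / 2 : ℝ) * ent R 2 k) := by
    intro u k
    simp only [PiLp.add_apply, PiLp.smul_apply, smul_eq_mul, apply_coord R, apply_coord R.symm, ent_symm]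
    ring
  simp_rw [h]
  rw [sum_cross_lin hframe (F := fun u : ↥Pat => (1 / 2 : ℝ) • R (u : E3) + (1 / 2 : ℝ) • R.symm (u : E3))
    (g := fun k l => (1 / 2 : ℝ) * ent R k l + (1 / 2 : ℝ) * ent R l k) hF]
  apply ext3 <;> simp only [PiLp.smul_apply, smul_eq_mul, vec3_apply_zero, vec3_apply_one, vec3_apply_two,
    PiLp.zero_apply] <;> ring

/-- The least-squares gauge `lsGauge` in cross-product form: `Σ_u u × x_u = 0`. [folklore] -/
theorem lsGauge_iff_sum_cross (x : ↥Pat → E3) : lsGauge Pat x ↔ ∑ u : ↥Pat, cross (u : E3) (x u) = 0 := by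
  constructor
  · rintro ⟨h0, h1, h2⟩
    apply ext3
    · simpa only [finset_sum_apply, cross_apply_zero, PiLp.zero_apply] using h0
    · simpa only [finset_sum_apply, cross_apply_one, PiLp.zero_apply] using h1
    · simpa only [finset_sum_apply, cross_apply_two, PiLp.zero_apply] using h2
  · intro h
    refine ⟨?_, ?_, ?_⟩
    · simpa only [finset_sum_apply, cross_apply_zero, PiLp.zero_apply] using congrArg (fun w : E3 => w 0) h
    · simpa only [finset_sum_apply, cross_apply_one, PiLp.zero_apply] using congrArg (fun w : E3 => w 1) h
    · simpa only [finset_sum_apply, cross_apply_two, PiLp.zero_apply] using congrArg (fun w : E3 => w 2) h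

end Frame

end Summit.AtomisticToContinuum.Crystallization.Theorems.FrustratedLawDichotomyTwoShellRigidityLsLedger
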